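import Mathlib
import HarnessLib
import Literature.Geometry.DiscreteGeometry.BondGraph
import Literature.Geometry.DiscreteGeometry.KissingPatterns
import Summits.AtomisticToContinuum.Crystallization.Theses.PricedLinkCensus

/-!
# Exact labelled charts at charge-free sites (crux `SoftLayerPropagation`, line `Sketch`)

Route `PricedLinkCensus`, crux `SoftLayerPropagation` (stmt-AtomisticToContinuum-14233), line
`Sketch`, stub `stub_chartAssembly`: pure bookkeeping.  The two analytic twelve-point statements of
the line —

* `H1` (soft link theorem, twelve-point unit form, = the hypothesis `H` of
  `Theorems.softFourRings_of_twelve_unit`): twelve points `z j` with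
  `1 ≤ ‖z j‖ ≤ (1+η) min 1 (n j)`, `n j ≤ ‖z j‖`, `n j ≤ dist (z j) (z k)` (`j ≠ k`) and soft link
  `4`-regular are `1/4`-matched to a rotated FCC/HCP pattern `A P`;
* `H2` (link edges): under such a matching two BONDED points are matched to pattern points at
  distance exactly `1` —

give every charge-free site `j` of positive scale `nn_j` an exact labelled CHART: a pattern
`P ∈ {fcc, hcp}`, a linear isometry `A` and labels `m : pattern point ↦ site` with `m p` a
bond-neighbour of `j` within `nn_j / 4` of `y j + nn_j • A p`, `m` injective on `P`, the bonds
among labelled sites exactly the pattern contacts `dist p q = 1`, and every bond-neighbour of `j`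
labelled.

Proof.  Enumerate the twelve bond-neighbours of `j` (`Finite.equivFinOfCardEq`), normalise centre
`0` and scale `1` exactly as in `Theorems.softFourRings_of_twelve(_unit)`, apply `H1`; label each
pattern point by a link site within `1/4` of it (`Classical.epsilon`).  Injectivity: two pattern
points within `1/4` of one site are within `1/2 < 1` of each other, but distinct pattern points
are `≥ 1` apart.  `→` of the graph isomorphism is `H2`.  `←` and surjectivity by counting: `m` is
an injection of the `12` pattern points into the `12` neighbours, hence a bijection; a neighbour has
exactly `4` bonded neighbours in the link (ring number `4`), they are labelled by `4` pattern points
at distance `1` from its own label (`→`), and a pattern point has exactly `4` pattern points at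
distance `1` (the cuboctahedron and the anticuboctahedron are `4`-regular: a `decide` over the
integer models `fccInt`, `hcpInt`), so these are all of them.
-/

noncomputable section

namespace Summit.AtomisticToContinuum.Crystallization.Theorems

open Literature.Geometry.DiscreteGeometry

/-! ### The FCC and HCP patterns are `4`-regular at contact distance `1` -/

/-- In a scaled integer pattern `{v/√N}`, `dist (v/√N) (w/√N) = 1 ↔ |v − w|² = N`. [folklore] -/
theorem dist_scaled_intVec_eq_one_iff {N : ℕ} (hN : N ≠ 0) (v w : Fin 3 → ℤ) :
    dist ((Real.sqrt N)⁻¹ • intVec v : EuclideanSpace ℝ (Fin 3))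
        ((Real.sqrt N)⁻¹ • intVec w) = 1 ↔ sqNormInt (v - w) = N := by
  have hpos : (0 : ℝ) < Real.sqrt N := by positivity
  have h0 : (0 : ℝ) ≤ (sqNormInt (v - w) : ℝ) := by
    have : (0 : ℤ) ≤ sqNormInt (v - w) := by unfold sqNormInt; positivity
    exact_mod_cast this
  rw [dist_eq_norm, ← smul_sub, intVec_sub, norm_smul, norm_inv, Real.norm_of_nonneg hpos.le,
    norm_intVec, inv_mul_eq_one₀ hpos.ne', eq_comm, Real.sqrt_inj h0 (Nat.cast_nonneg _)]
  constructor
  · intro h; exact_mod_cast h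
  · intro h; exact_mod_cast h

/-- In a scaled integer pattern, the points at distance exactly `1` from `v/√N` are counted by the
`w ∈ S` with `|v − w|² = N`. [folklore] -/
theorem card_filter_dist_eq_one_scaledPattern {S : Finset (Fin 3 → ℤ)} {N : ℕ} (hN : N ≠ 0)
    (v : Fin 3 → ℤ) :
    ((scaledPattern S N).filter fun q =>
        dist ((Real.sqrt N)⁻¹ • intVec v : EuclideanSpace ℝ (Fin 3)) q = 1).card =
      (S.filter fun w => sqNormInt (v - w) = N).card := by
  rw [scaledPattern, Finset.filter_image,
    Finset.card_image_of_injective _ (scaledPattern_map_injective hN)]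
  congr 1
  exact Finset.filter_congr fun w _ => dist_scaled_intVec_eq_one_iff hN v w

/-- The cuboctahedron is `4`-regular: every `v ∈ fccInt` has exactly four `w ∈ fccInt` with
`|v − w|² = 2`. [folklore] -/
theorem card_filter_fccInt_contact :
    ∀ v ∈ fccInt, (fccInt.filter fun w => sqNormInt (v - w) = (2 : ℕ)).card = 4 := by
  decide

/-- The anticuboctahedron is `4`-regular: every `v ∈ hcpInt` has exactly four `w ∈ hcpInt` with
`|v − w|² = 18`. [folklore] -/
theorem card_filter_hcpInt_contact :
    ∀ v ∈ hcpInt, (hcpInt.filter fun w => sqNormInt (v - w) = (18 : ℕ)).card = 4 := by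
  decide

/-- Every point of the FCC pattern is at distance exactly `1` from exactly four points of the
pattern. [folklore] -/
theorem card_filter_dist_eq_one_fcc {p : EuclideanSpace ℝ (Fin 3)}
    (hp : p ∈ fccKissingPattern) :
    (fccKissingPattern.filter fun q => dist p q = 1).card = 4 := by
  obtain ⟨v, hv, rfl⟩ := Finset.mem_image.1 hp
  rw [fccKissingPattern, card_filter_dist_eq_one_scaledPattern two_ne_zero]
  exact card_filter_fccInt_contact v hv

/-- Every point of the HCP pattern is at distance exactly `1` from exactly four points of the
pattern. [folklore] -/
theorem card_filter_dist_eq_one_hcp {p : EuclideanSpace ℝ (Fin 3)}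
    (hp : p ∈ hcpKissingPattern) :
    (hcpKissingPattern.filter fun q => dist p q = 1).card = 4 := by
  obtain ⟨v, hv, rfl⟩ := Finset.mem_image.1 hp
  rw [hcpKissingPattern, card_filter_dist_eq_one_scaledPattern (by norm_num)]
  exact card_filter_hcpInt_contact v hv

/-! ### The chart -/

/-- **Chart assembly** (stub `stub_chartAssembly` of line `Sketch`, crux `SoftLayerPropagation`).
Given the twelve-point soft link theorem `H1` (a soft `4`-regular link at `η ≤ 1/100` is
`1/4`-matched to a rotated FCC/HCP pattern) and the link-edge statement `H2` (bonded link sites are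
matched to pattern points at distance exactly `1`), every charge-free site `j` with `nn_j > 0` has
an exact labelled chart: a pattern `P` (FCC or HCP), a linear isometry `A` and labels
`m : pattern point ↦ site` with `m p` a bond-neighbour of `j` within `nn_j/4` of `y j + nn_j • A p`,
`m` injective on `P`, bonds between labelled sites exactly the pattern contacts (`dist p q = 1`),
and every bond-neighbour of `j` labelled.  (Enumerate the twelve neighbours, normalise
`y j = 0`, `nn_j = 1`; injectivity since pattern points are `≥ 1` apart; `→` of the graph
isomorphism is `H2`, `←` and surjectivity by counting degrees `4`/`12`.) -/
theorem stub_chartAssembly :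
    (∀ η : ℝ, 0 < η → η ≤ 1 / 100 →
      ∀ (z : Fin 12 → EuclideanSpace ℝ (Fin 3)) (n : Fin 12 → ℝ),
        (∀ j, 1 ≤ ‖z j‖) →
        (∀ j, ‖z j‖ ≤ (1 + η) * min 1 (n j)) →
        (∀ j, n j ≤ ‖z j‖) →
        (∀ j k, j ≠ k → n j ≤ dist (z j) (z k)) →
        (∀ j, (Finset.univ.filter (fun k : Fin 12 =>
            k ≠ j ∧ dist (z j) (z k) ≤ (1 + η) * min (n j) (n k))).card = 4) →
        ∃ (A : EuclideanSpace ℝ (Fin 3) →ₗᵢ[ℝ] EuclideanSpace ℝ (Fin 3))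
          (P : Finset (EuclideanSpace ℝ (Fin 3))),
          (P = Literature.Geometry.DiscreteGeometry.fccKissingPattern ∨
            P = Literature.Geometry.DiscreteGeometry.hcpKissingPattern) ∧
            ∀ p ∈ P, ∃ j : Fin 12, dist (z j) (A p) ≤ 1 / 4) →
    (∀ η : ℝ, 0 < η → η ≤ 1 / 100 →
      ∀ (z : Fin 12 → EuclideanSpace ℝ (Fin 3)) (n : Fin 12 → ℝ),
        (∀ j, 1 ≤ ‖z j‖) →
        (∀ j, ‖z j‖ ≤ (1 + η) * min 1 (n j)) →
        (∀ j, n j ≤ ‖z j‖) →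
        (∀ j k, j ≠ k → n j ≤ dist (z j) (z k)) →
        (∀ j, (Finset.univ.filter (fun k : Fin 12 =>
            k ≠ j ∧ dist (z j) (z k) ≤ (1 + η) * min (n j) (n k))).card = 4) →
        ∀ (A : EuclideanSpace ℝ (Fin 3) →ₗᵢ[ℝ] EuclideanSpace ℝ (Fin 3))
          (P : Finset (EuclideanSpace ℝ (Fin 3))),
          (P = Literature.Geometry.DiscreteGeometry.fccKissingPattern ∨
            P = Literature.Geometry.DiscreteGeometry.hcpKissingPattern) →
          (∀ p ∈ P, ∃ j : Fin 12, dist (z j) (A p) ≤ 1 / 4) →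
          ∀ p ∈ P, ∀ q ∈ P, ∀ j k : Fin 12,
            dist (z j) (A p) ≤ 1 / 4 → dist (z k) (A q) ≤ 1 / 4 → j ≠ k →
            dist (z j) (z k) ≤ (1 + η) * min (n j) (n k) → dist p q = 1) →
    ∀ η : ℝ, 0 < η → η ≤ 1 / 100 →
      ∀ (N : ℕ) (y : Fin N → EuclideanSpace ℝ (Fin 3)) (j : Fin N),
        Literature.Geometry.DiscreteGeometry.IsChargeFree η y j →
        0 < Literature.Geometry.DiscreteGeometry.nearestDist y j →
        ∃ (P : Finset (EuclideanSpace ℝ (Fin 3)))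
          (A : EuclideanSpace ℝ (Fin 3) →ₗᵢ[ℝ] EuclideanSpace ℝ (Fin 3))
          (m : EuclideanSpace ℝ (Fin 3) → Fin N),
          (P = Literature.Geometry.DiscreteGeometry.fccKissingPattern ∨
            P = Literature.Geometry.DiscreteGeometry.hcpKissingPattern) ∧
          (∀ p ∈ P, (Literature.Geometry.DiscreteGeometry.bondGraph η y).Adj j (m p) ∧
            dist (y (m p)) (y j + Literature.Geometry.DiscreteGeometry.nearestDist y j • A p) ≤
              Literature.Geometry.DiscreteGeometry.nearestDist y j / 4) ∧
          (∀ p ∈ P, ∀ q ∈ P, m p = m q → p = q) ∧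
          (∀ p ∈ P, ∀ q ∈ P,
            ((Literature.Geometry.DiscreteGeometry.bondGraph η y).Adj (m p) (m q) ↔ dist p q = 1)) ∧
          (∀ k, (Literature.Geometry.DiscreteGeometry.bondGraph η y).Adj j k → ∃ p ∈ P, m p = k) := by
  intro H1 H2 η hη hη1 N y i hcf hpos
  -- enumerate the twelve bond-neighbours of `i` (as in `softFourRings_of_twelve`)
  set S : Set (Fin N) := (bondGraph η y).neighborSet i with hS
  have hfin : S.Finite := hcf.finite_neighborSet
  haveI : Finite S := hfin.to_subtype
  have hcard : Nat.card S = 12 := by rw [Nat.card_coe_set_eq]; exact hcf.1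
  set e : S ≃ Fin 12 := Finite.equivFinOfCardEq hcard with he
  set idx : Fin 12 → Fin N := fun k => ((e.symm k : S) : Fin N) with hidx
  have hidx_mem : ∀ k, idx k ∈ S := fun k => (e.symm k).2
  have hidx_inj : Function.Injective idx :=
    Subtype.val_injective.comp e.symm.injective
  have hidx_e : ∀ (x : Fin N) (hx : x ∈ S), idx (e ⟨x, hx⟩) = x := fun x hx => by
    simp [hidx]
  have hne_i : ∀ k, i ≠ idx k := fun k => (mem_neighborSet_bondGraph.1 (hidx_mem k)).1
  -- the five hypotheses of the twelve-point statements, un-normalised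
  have h1 : ∀ k, nearestDist y i ≤ dist (y i) (y (idx k)) := fun k =>
    nearestDist_le_dist y (hne_i k).symm
  have h2 : ∀ k, dist (y i) (y (idx k)) ≤
      (1 + η) * min (nearestDist y i) (nearestDist y (idx k)) := fun k =>
    (mem_neighborSet_bondGraph.1 (hidx_mem k)).2
  have h3 : ∀ k, nearestDist y (idx k) ≤ dist (y (idx k)) (y i) := fun k =>
    nearestDist_le_dist y (hne_i k)
  have h4 : ∀ j k : Fin 12, j ≠ k → nearestDist y (idx j) ≤ dist (y (idx j)) (y (idx k)) :=
    fun j k hjk => nearestDist_le_dist y (fun h => hjk (hidx_inj h).symm)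
  have h5 : ∀ j : Fin 12, (Finset.univ.filter (fun k : Fin 12 => k ≠ j ∧
      dist (y (idx j)) (y (idx k)) ≤
        (1 + η) * min (nearestDist y (idx j)) (nearestDist y (idx k)))).card = 4 := by
    intro j
    have hring : ringNumber η y i (idx j) = 4 := hcf.2 (idx j) (hidx_mem j)
    have himage : (bondGraph η y).neighborSet i ∩ (bondGraph η y).neighborSet (idx j) =
        idx '' ((Finset.univ.filter (fun k : Fin 12 => k ≠ j ∧
          dist (y (idx j)) (y (idx k)) ≤
            (1 + η) * min (nearestDist y (idx j)) (nearestDist y (idx k)))) :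
              Set (Fin 12)) := by
      ext x
      simp only [Set.mem_inter_iff, Set.mem_image, Finset.coe_filter, Finset.mem_univ, true_and,
        Set.mem_setOf_eq]
      constructor
      · rintro ⟨hxS, hxj⟩
        obtain ⟨hne, hdist⟩ := mem_neighborSet_bondGraph.1 hxj
        refine ⟨e ⟨x, hxS⟩, ⟨?_, ?_⟩, hidx_e x hxS⟩
        · intro heq
          apply hne
          rw [← hidx_e x hxS, heq]
        · rw [hidx_e x hxS]
          exact hdist
      · rintro ⟨k, ⟨hkj, hdist⟩, rfl⟩
        exact ⟨hidx_mem k, mem_neighborSet_bondGraph.2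
          ⟨fun h => hkj (hidx_inj h).symm, hdist⟩⟩
    rw [ringNumber_def, himage, Set.ncard_image_of_injective _ hidx_inj,
      Set.ncard_coe_finset] at hring
    exact hring
  -- normalise: centre `0`, scale `1` (as in `softFourRings_of_twelve_unit`)
  set s : ℝ := nearestDist y i with hs
  set c : EuclideanSpace ℝ (Fin 3) := y i with hc
  have hs' : 0 < s⁻¹ := inv_pos.2 hpos
  set z' : Fin 12 → EuclideanSpace ℝ (Fin 3) := fun j => s⁻¹ • (y (idx j) - c) with hz'
  set n' : Fin 12 → ℝ := fun j => s⁻¹ * nearestDist y (idx j) with hn'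
  have hnorm : ∀ j, ‖z' j‖ = s⁻¹ * dist (y (idx j)) c := fun j => by
    rw [hz', norm_smul, Real.norm_eq_abs, abs_of_pos hs', dist_eq_norm]
  have hdist : ∀ j k, dist (z' j) (z' k) = s⁻¹ * dist (y (idx j)) (y (idx k)) := fun j k => by
    rw [hz', dist_smul₀, Real.norm_eq_abs, abs_of_pos hs', dist_sub_right]
  have hmin : ∀ j k, min (n' j) (n' k) =
      s⁻¹ * min (nearestDist y (idx j)) (nearestDist y (idx k)) := fun j k => by
    rw [hn', mul_min_of_nonneg _ _ hs'.le]
  have g1 : ∀ j, 1 ≤ ‖z' j‖ := fun j => by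
    rw [hnorm, dist_comm, le_inv_mul_iff₀ hpos, mul_one]
    exact h1 j
  have g2 : ∀ j, ‖z' j‖ ≤ (1 + η) * min 1 (n' j) := fun j => by
    have : min 1 (n' j) = s⁻¹ * min s (nearestDist y (idx j)) := by
      rw [hn', mul_min_of_nonneg _ _ hs'.le, inv_mul_cancel₀ hpos.ne']
    rw [hnorm, this, dist_comm, mul_left_comm]
    exact mul_le_mul_of_nonneg_left (h2 j) hs'.le
  have g3 : ∀ j, n' j ≤ ‖z' j‖ := fun j => by
    rw [hnorm, hn']
    exact mul_le_mul_of_nonneg_left (h3 j) hs'.le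
  have g4 : ∀ j k, j ≠ k → n' j ≤ dist (z' j) (z' k) := fun j k hjk => by
    rw [hdist, hn']
    exact mul_le_mul_of_nonneg_left (h4 j k hjk) hs'.le
  have g5 : ∀ j, (Finset.univ.filter (fun k : Fin 12 =>
      k ≠ j ∧ dist (z' j) (z' k) ≤ (1 + η) * min (n' j) (n' k))).card = 4 := fun j => by
    rw [← h5 j]
    congr 1
    refine Finset.filter_congr fun k _ => ?_
    rw [hdist, hmin, mul_left_comm, mul_le_mul_iff_right₀ hs']
  have hzk : ∀ k, y (idx k) = c + s • z' k := fun k => by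
    rw [hz', smul_smul, mul_inv_cancel₀ hpos.ne', one_smul, add_sub_cancel]
  -- the soft link theorem: a rotated pattern `A P` is `1/4`-matched to the normalised link
  obtain ⟨A, P, hP, hmatch⟩ := H1 η hη hη1 z' n' g1 g2 g3 g4 g5
  -- the link-edge statement for this matching
  have hedge := H2 η hη hη1 z' n' g1 g2 g3 g4 g5 A P hP hmatch
  -- pattern facts: twelve points, `≥ 1` apart, each touching exactly four others
  have hPcard : P.card = 12 := by
    rcases hP with rfl | rfl
    exacts [card_fccKissingPattern, card_hcpKissingPattern]
  have hP1 : ∀ p ∈ P, ∀ q ∈ P, p ≠ q → 1 ≤ dist p q := by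
    rcases hP with rfl | rfl
    · exact fun p hp q hq hpq => one_le_dist_of_mem_fccKissingPattern hp hq hpq
    · exact fun p hp q hq hpq => one_le_dist_of_mem_hcpKissingPattern hp hq hpq
  have hPdeg : ∀ p ∈ P, (P.filter fun q => dist p q = 1).card = 4 := by
    rcases hP with rfl | rfl
    · exact fun p hp => card_filter_dist_eq_one_fcc hp
    · exact fun p hp => card_filter_dist_eq_one_hcp hp
  -- the label of a pattern point: a link site within `1/4` of `A p`
  set sel : EuclideanSpace ℝ (Fin 3) → Fin 12 :=
    fun p => Classical.epsilon fun k => dist (z' k) (A p) ≤ 1 / 4 with hsel_def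
  have hsel : ∀ p ∈ P, dist (z' (sel p)) (A p) ≤ 1 / 4 := fun p hp =>
    Classical.epsilon_spec (hmatch p hp)
  -- labels are injective on `P`: pattern points are `≥ 1` apart
  have hsel_inj : ∀ p ∈ P, ∀ q ∈ P, sel p = sel q → p = q := by
    intro p hp q hq hpq
    by_contra hne
    have hfar := hP1 p hp q hq hne
    have hnear : dist p q ≤ 1 / 2 := by
      rw [← A.dist_map p q]
      calc dist (A p) (A q) ≤ dist (A p) (z' (sel p)) + dist (z' (sel p)) (A q) :=
            dist_triangle _ _ _
        _ ≤ 1 / 4 + 1 / 4 := by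
          refine add_le_add ?_ ?_
          · rw [dist_comm]; exact hsel p hp
          · rw [hpq]; exact hsel q hq
        _ = 1 / 2 := by norm_num
    linarith
  -- `→` of the graph isomorphism: bonds are pattern contacts (`H2`)
  have hfwd : ∀ p ∈ P, ∀ q ∈ P,
      (bondGraph η y).Adj (idx (sel p)) (idx (sel q)) → dist p q = 1 := by
    intro p hp q hq hadj
    obtain ⟨hne, hle⟩ := bondGraph_adj.1 hadj
    have hne' : sel p ≠ sel q := fun h => hne (by rw [h])
    refine hedge p hp q hq (sel p) (sel q) (hsel p hp) (hsel q hq) hne' ?_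
    rw [hdist, hmin, mul_left_comm, mul_le_mul_iff_right₀ hs']
    exact hle
  -- `sel` is a bijection from `P` onto `Fin 12` (injection between sets of twelve)
  have hinjOn : Set.InjOn sel ↑P := by
    intro p hp q hq h
    exact hsel_inj p hp q hq h
  have himage : P.image sel = Finset.univ := by
    apply Finset.eq_univ_of_card
    rw [Finset.card_image_of_injOn hinjOn, hPcard, Fintype.card_fin]
  have hsurj : ∀ k : Fin 12, ∃ q ∈ P, sel q = k := fun k => by
    have hk : k ∈ P.image sel := by rw [himage]; exact Finset.mem_univ k
    exact Finset.mem_image.1 hk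
  choose inv hinvP hinv using hsurj
  have hinv_inj : Function.Injective inv := fun a b h => by
    rw [← hinv a, ← hinv b, h]
  refine ⟨P, A, fun p => idx (sel p), hP, ?_, ?_, ?_, ?_⟩
  · -- labelled sites are bond-neighbours, `nn_i / 4`-close to the rotated scaled pattern
    intro p hp
    refine ⟨hidx_mem (sel p), ?_⟩
    show dist (y (idx (sel p))) (c + s • A p) ≤ s / 4
    rw [hzk (sel p), dist_add_left, dist_smul₀, Real.norm_eq_abs, abs_of_pos hpos]
    calc s * dist (z' (sel p)) (A p) ≤ s * (1 / 4) :=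
          mul_le_mul_of_nonneg_left (hsel p hp) hpos.le
      _ = s / 4 := by ring
  · -- injectivity
    intro p hp q hq h
    exact hsel_inj p hp q hq (hidx_inj h)
  · -- graph isomorphism
    intro p hp q hq
    refine ⟨hfwd p hp q hq, fun hpq => ?_⟩
    -- counting: the four link-neighbours of `sel p` are labelled by four pattern points at
    -- distance `1` from `p`, and `p` has only four such
    set F : Finset (Fin 12) := Finset.univ.filter (fun k : Fin 12 => k ≠ sel p ∧
      dist (y (idx (sel p))) (y (idx k)) ≤
        (1 + η) * min (nearestDist y (idx (sel p))) (nearestDist y (idx k))) with hF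
    have hsub : F.image inv ⊆ P.filter (fun q' => dist p q' = 1) := by
      intro x hx
      obtain ⟨k', hk', rfl⟩ := Finset.mem_image.1 hx
      obtain ⟨hk'ne, hk'le⟩ := (Finset.mem_filter.1 hk').2
      refine Finset.mem_filter.2 ⟨hinvP k', hfwd p hp (inv k') (hinvP k') ?_⟩
      rw [hinv k']
      exact bondGraph_adj.2 ⟨fun h => hk'ne (hidx_inj h).symm, hk'le⟩
    have hcardF : (F.image inv).card = 4 := by
      rw [Finset.card_image_of_injective _ hinv_inj, hF]
      exact h5 (sel p)
    have heq : F.image inv = P.filter (fun q' => dist p q' = 1) :=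
      Finset.eq_of_subset_of_card_le hsub (by rw [hcardF, hPdeg p hp])
    have hqmem : q ∈ F.image inv := by
      rw [heq]
      exact Finset.mem_filter.2 ⟨hq, hpq⟩
    obtain ⟨k', hk', hk'q⟩ := Finset.mem_image.1 hqmem
    obtain ⟨hk'ne, hk'le⟩ := (Finset.mem_filter.1 hk').2
    show (bondGraph η y).Adj (idx (sel p)) (idx (sel q))
    rw [← hk'q, hinv k']
    exact bondGraph_adj.2 ⟨fun h => hk'ne (hidx_inj h).symm, hk'le⟩
  · -- every bond-neighbour of `i` is labelled
    intro k hk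
    obtain ⟨hq, hsq⟩ := And.intro (hinvP (e ⟨k, hk⟩)) (hinv (e ⟨k, hk⟩))
    refine ⟨inv (e ⟨k, hk⟩), hq, ?_⟩
    show idx (sel (inv (e ⟨k, hk⟩))) = k
    rw [hsq]
    exact hidx_e k hk

end Summit.AtomisticToContinuum.Crystallization.Theorems

end
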